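import Summits.Ventures.PercRepro.ProfilePointedCircuitClassesFiveParallelPair
import Summits.Ventures.PercRepro.ProfilePointedCircuitClassesFourteenSeries

/-!
# PercRepro — THE `q = 7` ROW AT `n = 14` ON EVERY MATROID WITH TWO PARALLEL PAIRS (OR A PARALLEL TRIPLE) (p5, gen 50;
`proofs/P5-GM1.md` §75 ADDENDUM 2)

The minor-quantified chain of §65(m) gives the co-rank-7 top threshold `ThresholdIneq N 7 7` on `#E = 14`, `ρ(E) = 8`
from the twelve-point statement on the minors `N ／ x ∖ w` (`InOutMinors N`; the per-pair statement on the minors is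
§64's theorem `inOutPairMinors_of_fourteen`).  If `N` has two parallel pairs `{y, y'}`, `{z, z'}` in different parallel
classes, then EVERY minor `N ／ x ∖ w` (x a non-loop) either contains a LOOP — then it has no bi-independent set at
all and `in_5(e) = 0` — or keeps one of the pairs as a pair of parallel non-loops, where gen 50's
`inCount_five_le_outCount_six_of_twelve_of_parallel_pair` applies.  (Contracting a point of the class of `{y, y'}`
turns the rest of the class into loops of the minor; contracting a point outside it keeps `y ∥ y'`; deleting one point
of a pair breaks only that pair.)  A parallel class of size `≥ 3` works the same way.  Hence the fifth and sixth
instance families of the `(14, 8)` row (after girth `≥ 8`, `Quad2Del`, the sparse regime and a series class of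
size `≥ 4`): `thresholdIneq_seven_top_of_fourteen_of_two_parallel_pairs`, `…_of_parallel_triple`, and Theorem A's
step `8·P_6 ≤ 7·P_7` there.
-/

open scoped Matroid

namespace PercRepro.Cogirth

open Finset ThmH Skew Shadow Profile

variable {α : Type} [DecidableEq α] {N : Matroid α} [N.Finite]

section FourteenParallel

/-- A matroid with a loop has no bi-independent set: the loop would lie in the set or in its complement, both
independent. -/
theorem biIndepSets_eq_empty_of_loop {M : Matroid α} [M.Finite] {l : α} (hl : l ∈ gr M) (h0 : rk M {l} = 0)
    (k : ℕ) : biIndepSets M k = ∅ := by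
  rw [eq_empty_iff_forall_notMem]
  intro W hW
  rw [mem_biIndepSets] at hW
  obtain ⟨hWg, _, hWr, hWc⟩ := hW
  by_cases hlW : l ∈ W
  · have h := rk_eq_card_of_subset_of_rk_eq_card (singleton_subset_iff.2 hlW) hWr
    rw [card_singleton] at h
    omega
  · have h := rk_eq_card_of_subset_of_rk_eq_card (singleton_subset_iff.2 (mem_sdiff.2 ⟨hl, hlW⟩)) hWc
    rw [card_singleton] at h
    omega

/-- With a loop anywhere, `in_k(e) = 0`. -/
theorem inCount_eq_zero_of_loop_mem {M : Matroid α} [M.Finite] {l : α} (hl : l ∈ gr M) (h0 : rk M {l} = 0)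
    (k : ℕ) (e : α) : inCount M k e = 0 := by
  unfold inCount
  rw [biIndepSets_eq_empty_of_loop hl h0 k, filter_empty, card_empty]

/-- **THE TWELVE-POINT STATEMENT ON A MINOR WITH A LOOP OR A PARALLEL PAIR** (the case split used for the
`(14, 8)` row). -/
theorem inCount_five_le_outCount_six_of_twelve_of_loop_or_parallel {M : Matroid α} [M.Finite]
    (hn : (gr M).card = 12) (hR : rk M (gr M) = 7) {e : α} (he : e ∈ gr M)
    (h : (∃ l ∈ gr M, rk M {l} = 0) ∨
      (∃ u ∈ gr M, ∃ u' ∈ gr M, u ≠ u' ∧ rk M {u} = 1 ∧ rk M {u'} = 1 ∧ u' ∈ clF M {u})) :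
    inCount M 5 e ≤ outCount M 6 e := by
  rcases h with ⟨l, hl, h0⟩ | ⟨u, hu, u', hu', huu', hru, hru', hcl⟩
  · rw [inCount_eq_zero_of_loop_mem hl h0 5 e]
    exact Nat.zero_le _
  · exact inCount_five_le_outCount_six_of_twelve_of_parallel_pair hn hR hu hu' huu' hru hru' hcl he

/-- In the minor `N ／ x ∖ w` a point `u ∉ {x, w}` parallel to `x` (i.e. `u ∈ cl{x}`) is a loop. -/
theorem rk_minor_singleton_eq_zero_of_mem_clF {x w u : α} (hxg : x ∈ gr N) (hx1 : rk N {x} = 1) (hu : u ∈ gr N)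
    (hux : u ≠ x) (huw : u ≠ w) (hcl : u ∈ clF N {x}) :
    rk ((N ／ ({x} : Set α)) ＼ ({w} : Set α)) {u} = 0 := by
  have hu₀ : ({u} : Finset α) ⊆ gr ((N ／ ({x} : Set α)) ＼ ({w} : Set α)) := by
    rw [gr_delete', gr_contract']
    exact singleton_subset_iff.2 (mem_erase.2 ⟨huw, mem_erase.2 ⟨hux, hu⟩⟩)
  have h := rk_minor_add_one hx1 hu₀
  have h2 : rk N (insert x {u}) = rk N {x} := by
    rw [show insert x ({u} : Finset α) = insert u {x} from pair_comm x u]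
    exact (mem_clF_iff_rk_insert_eq hu (singleton_subset_iff.2 hxg)).1 hcl
  omega

/-- In the minor `N ／ x ∖ w` two parallel non-loops `u, u' ∉ {x, w}` of `N` not parallel to `x` stay parallel
non-loops. -/
theorem parallel_minor {x w u u' : α} (hxg : x ∈ gr N) (hx1 : rk N {x} = 1) (hu : u ∈ gr N) (hu' : u' ∈ gr N)
    (hux : u ≠ x) (huw : u ≠ w) (hu'x : u' ≠ x) (hu'w : u' ≠ w) (hru : rk N {u} = 1) (hru' : rk N {u'} = 1)
    (hcl : u' ∈ clF N {u}) (hxu : x ∉ clF N {u}) :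
    u ∈ gr ((N ／ ({x} : Set α)) ＼ ({w} : Set α)) ∧ u' ∈ gr ((N ／ ({x} : Set α)) ＼ ({w} : Set α)) ∧
    rk ((N ／ ({x} : Set α)) ＼ ({w} : Set α)) {u} = 1 ∧ rk ((N ／ ({x} : Set α)) ＼ ({w} : Set α)) {u'} = 1 ∧
    u' ∈ clF ((N ／ ({x} : Set α)) ＼ ({w} : Set α)) {u} := by
  have hgr : gr ((N ／ ({x} : Set α)) ＼ ({w} : Set α)) = ((gr N).erase x).erase w := by
    rw [gr_delete', gr_contract']
  have hu₀ : u ∈ gr ((N ／ ({x} : Set α)) ＼ ({w} : Set α)) := by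
    rw [hgr]; exact mem_erase.2 ⟨huw, mem_erase.2 ⟨hux, hu⟩⟩
  have hu'₀ : u' ∈ gr ((N ／ ({x} : Set α)) ＼ ({w} : Set α)) := by
    rw [hgr]; exact mem_erase.2 ⟨hu'w, mem_erase.2 ⟨hu'x, hu'⟩⟩
  -- `x ∉ cl{u'}` as well: parallelism is symmetric and `cl{u} = cl{u'}`
  have hcl' : u ∈ clF N {u'} := mem_clF_singleton_of_parallel hu hu' hru hru' hcl
  have hxu2 : rk N (insert x {u}) = 2 := by
    rw [rk_insert_eq hxg (singleton_subset_iff.2 hu), if_neg hxu, hru]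
  have hxu'2 : rk N (insert x {u'}) = 2 := by
    by_contra hne
    have hle := rk_insert_le (M := N) x ({u'} : Finset α)
    have hlo := rk_mono' (M := N) (singleton_subset_iff.2 (mem_insert_self x {u'}))
    have heq : rk N (insert x {u'}) = 1 := by omega
    -- `{x, u'}` and `{u, u'}` both have rank `1`; submodularity puts `{x, u, u'}` at rank `≤ 1`, against `ρ{x, u} = 2`
    have h4 : rk N (insert u {u'}) = rk N {u'} :=
      (mem_clF_iff_rk_insert_eq hu (singleton_subset_iff.2 hu')).1 hcl'
    have hsub := rk_union_add_rk_inter_le (M := N) (insert x ({u'} : Finset α)) (insert u ({u'} : Finset α))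
    have e1 : insert x ({u'} : Finset α) ∪ insert u ({u'} : Finset α) = insert x (insert u ({u'} : Finset α)) := by
      ext a; simp only [mem_union, mem_insert, mem_singleton]; tauto
    have e2 : insert x ({u'} : Finset α) ∩ insert u ({u'} : Finset α) = ({u'} : Finset α) := by
      ext a
      simp only [mem_inter, mem_insert, mem_singleton]
      constructor
      · rintro ⟨h1 | h1, h2 | h2⟩
        · exact absurd (h1.symm.trans h2) hux.symm
        · exact h2
        · exact h1
        · exact h1
      · intro h1; exact ⟨Or.inr h1, Or.inr h1⟩
    rw [e1, e2, heq, h4, hru'] at hsub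
    have h10 : rk N (insert x {u}) ≤ rk N (insert x (insert u {u'})) :=
      rk_mono' (insert_subset_insert x (singleton_subset_iff.2 (mem_insert_self u {u'})))
    omega
  refine ⟨hu₀, hu'₀, ?_, ?_, ?_⟩
  · have h := rk_minor_add_one hx1 (singleton_subset_iff.2 hu₀)
    omega
  · have h := rk_minor_add_one hx1 (singleton_subset_iff.2 hu'₀)
    omega
  · rw [mem_clF_iff_rk_insert_eq hu'₀ (singleton_subset_iff.2 hu₀)]
    have h1 := rk_minor_add_one hx1 (insert_subset hu'₀ (singleton_subset_iff.2 hu₀))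
    have h2 := rk_minor_add_one hx1 (singleton_subset_iff.2 hu₀)
    -- `ρ_N{x, u', u} = ρ_N{x, u} = 2` since `u' ∈ cl{u}`
    have h3 : rk N (insert x (insert u' {u})) = rk N (insert x {u}) := by
      have hA : rk N (insert u' (insert x {u})) = rk N (insert x {u}) := by
        have := rk_insert_eq hu' (insert_subset hxg (singleton_subset_iff.2 hu)) (M := N)
        rw [if_pos (clF_mono (M := N) (subset_insert x {u}) hcl)] at this
        exact this
      rw [insert_comm]; exact hA
    omega


/-- Parallelism is transitive on non-loops: `y ∈ cl{x}` and `z ∈ cl{y}` give `z ∈ cl{x}`. -/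
theorem mem_clF_singleton_trans {x y z : α} (hx : x ∈ gr N) (hy : y ∈ gr N) (hz : z ∈ gr N)
    (hxy : y ∈ clF N {x}) (hyz : z ∈ clF N {y}) : z ∈ clF N {x} := by
  have h1 : rk N (insert y {x}) = rk N {x} := (mem_clF_iff_rk_insert_eq hy (singleton_subset_iff.2 hx)).1 hxy
  have hA : insert y ({x} : Finset α) ⊆ gr N := insert_subset hy (singleton_subset_iff.2 hx)
  have h2 : z ∈ clF N (insert y {x}) := clF_mono_sub (singleton_subset_iff.2 (mem_insert_self y {x})) hyz
  have h3 : rk N (insert z (insert y {x})) = rk N (insert y {x}) := (mem_clF_iff_rk_insert_eq hz hA).1 h2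
  have h4 : rk N (insert z {x}) ≤ rk N (insert z (insert y {x})) :=
    rk_mono' (insert_subset_insert z (singleton_subset_iff.2 (mem_insert_of_mem (mem_singleton_self x))))
  have h5 : rk N {x} ≤ rk N (insert z {x}) := rk_mono' (subset_insert z {x})
  rw [mem_clF_iff_rk_insert_eq hz (singleton_subset_iff.2 hx)]
  omega

/-- A point `u ∉ {x, w}` of `N` parallel to `x` is a loop of the minor `N ／ x ∖ w` (packaged as an existential). -/
theorem exists_loop_minor_of_mem_clF {x w u : α} (hxg : x ∈ gr N) (hx1 : rk N {x} = 1) (hu : u ∈ gr N)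
    (hux : u ≠ x) (huw : u ≠ w) (hcl : u ∈ clF N {x}) :
    ∃ l ∈ gr ((N ／ ({x} : Set α)) ＼ ({w} : Set α)), rk ((N ／ ({x} : Set α)) ＼ ({w} : Set α)) {l} = 0 := by
  refine ⟨u, ?_, rk_minor_singleton_eq_zero_of_mem_clF hxg hx1 hu hux huw hcl⟩
  rw [gr_delete', gr_contract']
  exact mem_erase.2 ⟨huw, mem_erase.2 ⟨hux, hu⟩⟩

/-- Two parallel non-loops `u, u' ∉ {x, w}` of `N` with `x ∉ cl{u}` give a parallel pair of the minor (packaged as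
an existential). -/
theorem exists_parallel_minor {x w u u' : α} (hxg : x ∈ gr N) (hx1 : rk N {x} = 1) (hu : u ∈ gr N)
    (hu' : u' ∈ gr N) (hux : u ≠ x) (huw : u ≠ w) (hu'x : u' ≠ x) (hu'w : u' ≠ w) (huu' : u ≠ u')
    (hru : rk N {u} = 1) (hru' : rk N {u'} = 1) (hcl : u' ∈ clF N {u}) (hxu : x ∉ clF N {u}) :
    ∃ p ∈ gr ((N ／ ({x} : Set α)) ＼ ({w} : Set α)), ∃ p' ∈ gr ((N ／ ({x} : Set α)) ＼ ({w} : Set α)),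
      p ≠ p' ∧ rk ((N ／ ({x} : Set α)) ＼ ({w} : Set α)) {p} = 1 ∧
      rk ((N ／ ({x} : Set α)) ＼ ({w} : Set α)) {p'} = 1 ∧ p' ∈ clF ((N ／ ({x} : Set α)) ＼ ({w} : Set α)) {p} := by
  obtain ⟨h1, h2, h3, h4, h5⟩ := parallel_minor hxg hx1 hu hu' hux huw hu'x hu'w hru hru' hcl hxu
  exact ⟨u, h1, u', h2, huu', h3, h4, h5⟩

/-- **THE MINORS' TWELVE-POINT STATEMENT ON `14` POINTS WITH TWO PARALLEL PAIRS IN DIFFERENT CLASSES**: every minor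
`N ／ x ∖ w` has a loop or a parallel pair. -/
theorem inOutMinors_of_two_parallel_pairs (hn : (gr N).card = 14) {y y' z z' : α} (hy : y ∈ gr N)
    (hy' : y' ∈ gr N) (hz : z ∈ gr N) (hz' : z' ∈ gr N) (hyy' : y ≠ y') (hzz' : z ≠ z') (hyz : y ≠ z)
    (hyz' : y ≠ z') (hy'z : y' ≠ z) (hy'z' : y' ≠ z') (hry : rk N {y} = 1) (hry' : rk N {y'} = 1)
    (hrz : rk N {z} = 1) (hrz' : rk N {z'} = 1) (hcly : y' ∈ clF N {y}) (hclz : z' ∈ clF N {z})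
    (hsep : z ∉ clF N {y}) : InOutMinors N := by
  intro x w e hxg hwg hxw hx1 he hn₀ hR₀
  have hgr : gr ((N ／ ({x} : Set α)) ＼ ({w} : Set α)) = ((gr N).erase x).erase w := by
    rw [gr_delete', gr_contract']
  have hcard : (gr ((N ／ ({x} : Set α)) ＼ ({w} : Set α))).card = 12 := by
    rw [hgr, card_erase_of_mem (mem_erase.2 ⟨hxw.symm, hwg⟩), card_erase_of_mem hxg, hn]
  have hrk₀ : rk ((N ／ ({x} : Set α)) ＼ ({w} : Set α)) (gr ((N ／ ({x} : Set α)) ＼ ({w} : Set α))) = 7 := by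
    omega
  apply inCount_five_le_outCount_six_of_twelve_of_loop_or_parallel hcard hrk₀ he
  -- symmetric facts
  have hcly' : y ∈ clF N {y'} := mem_clF_singleton_of_parallel hy hy' hry hry' hcly
  have hclz' : z ∈ clF N {z'} := mem_clF_singleton_of_parallel hz hz' hrz hrz' hclz
  have hsep' : z' ∉ clF N {y} := fun h => hsep (mem_clF_singleton_trans hy hz' hz h hclz')
  have hsepy' : z ∉ clF N {y'} := fun h => hsep (mem_clF_singleton_trans hy hy' hz hcly h)
  have hsepy'' : z' ∉ clF N {y'} := fun h => hsep' (mem_clF_singleton_trans hy hy' hz' hcly h)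
  by_cases hxy : x ∈ clF N {y}
  · -- `x` in the class of `y`: `y, y' ∈ cl{x}`
    have hyx : y ∈ clF N {x} := mem_clF_singleton_of_parallel hy hxg hry hx1 hxy
    have hy'x : y' ∈ clF N {x} := mem_clF_singleton_trans hxg hy hy' hyx hcly
    by_cases h1 : y ≠ x ∧ y ≠ w
    · exact Or.inl (exists_loop_minor_of_mem_clF hxg hx1 hy h1.1 h1.2 hyx)
    by_cases h2 : y' ≠ x ∧ y' ≠ w
    · exact Or.inl (exists_loop_minor_of_mem_clF hxg hx1 hy' h2.1 h2.2 hy'x)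
    -- `{y, y'} = {x, w}`: the other pair survives
    have hxin : x = y ∨ x = y' := by
      by_contra hcon
      push Not at hcon
      rcases not_and_or.1 h1 with h | h <;> rcases not_and_or.1 h2 with h' | h'
      · exact hcon.1 (by push Not at h; exact h.symm)
      · exact hcon.1 (by push Not at h; exact h.symm)
      · exact hcon.2 (by push Not at h'; exact h'.symm)
      · push Not at h h'
        exact hyy' (h.trans h'.symm)
    have hwin : w = y ∨ w = y' := by
      by_contra hcon
      push Not at hcon
      rcases not_and_or.1 h1 with h | h <;> rcases not_and_or.1 h2 with h' | h'
      · push Not at h h'; exact hyy' (h.trans h'.symm)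
      · exact hcon.2 (by push Not at h'; exact h'.symm)
      · exact hcon.1 (by push Not at h; exact h.symm)
      · exact hcon.1 (by push Not at h; exact h.symm)
    have hzx : z ≠ x := by rcases hxin with rfl | rfl <;> [exact hyz.symm; exact hy'z.symm]
    have hz'x : z' ≠ x := by rcases hxin with rfl | rfl <;> [exact hyz'.symm; exact hy'z'.symm]
    have hzw : z ≠ w := by rcases hwin with rfl | rfl <;> [exact hyz.symm; exact hy'z.symm]
    have hz'w : z' ≠ w := by rcases hwin with rfl | rfl <;> [exact hyz'.symm; exact hy'z'.symm]
    have hxz : x ∉ clF N {z} := by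
      intro hxz
      have hzx' : z ∈ clF N {x} := mem_clF_singleton_of_parallel hz hxg hrz hx1 hxz
      rcases hxin with rfl | rfl
      · exact hsep hzx'
      · exact hsepy' hzx'
    exact Or.inr (exists_parallel_minor hxg hx1 hz hz' hzx hzw hz'x hz'w hzz' hrz hrz' hclz hxz)
  · -- `x` outside the class of `y`
    have hxy1 : y ≠ x := fun h => hxy (h ▸ subset_clF_self_of_subset_gr (singleton_subset_iff.2 hy) (mem_singleton_self y))
    have hxy2 : y' ≠ x := fun h => hxy (h ▸ hcly)
    by_cases hw : y ≠ w ∧ y' ≠ w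
    · exact Or.inr (exists_parallel_minor hxg hx1 hy hy' hxy1 hw.1 hxy2 hw.2 hyy' hry hry' hcly hxy)
    -- `w ∈ {y, y'}`: use the other pair
    have hwin : w = y ∨ w = y' := by
      rcases not_and_or.1 hw with h | h
      · push Not at h; exact Or.inl h.symm
      · push Not at h; exact Or.inr h.symm
    have hzw : z ≠ w := by rcases hwin with rfl | rfl <;> [exact hyz.symm; exact hy'z.symm]
    have hz'w : z' ≠ w := by rcases hwin with rfl | rfl <;> [exact hyz'.symm; exact hy'z'.symm]
    by_cases hxz : x ∈ clF N {z}
    · have hzx : z ∈ clF N {x} := mem_clF_singleton_of_parallel hz hxg hrz hx1 hxz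
      have hz'x : z' ∈ clF N {x} := mem_clF_singleton_trans hxg hz hz' hzx hclz
      by_cases hzx1 : z ≠ x
      · exact Or.inl (exists_loop_minor_of_mem_clF hxg hx1 hz hzx1 hzw hzx)
      · push Not at hzx1
        have hz'x1 : z' ≠ x := fun h => hzz' (hzx1.trans h.symm)
        exact Or.inl (exists_loop_minor_of_mem_clF hxg hx1 hz' hz'x1 hz'w hz'x)
    · have hzx1 : z ≠ x := fun h => hxz (h ▸ subset_clF_self_of_subset_gr (singleton_subset_iff.2 hz) (mem_singleton_self z))
      have hz'x1 : z' ≠ x := fun h => hxz (h ▸ hclz)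
      exact Or.inr (exists_parallel_minor hxg hx1 hz hz' hzx1 hzw hz'x1 hz'w hzz' hrz hrz' hclz hxz)

/-- **THE MINORS' TWELVE-POINT STATEMENT ON `14` POINTS WITH A PARALLEL TRIPLE**: every minor `N ／ x ∖ w` has a loop
(if `x` is in the class) or keeps two of the three as a parallel pair. -/
theorem inOutMinors_of_parallel_triple (hn : (gr N).card = 14) {y y' y'' : α} (hy : y ∈ gr N)
    (hy' : y' ∈ gr N) (hy'' : y'' ∈ gr N) (hyy' : y ≠ y') (hyy'' : y ≠ y'') (hy'y'' : y' ≠ y'')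
    (hry : rk N {y} = 1) (hry' : rk N {y'} = 1) (hry'' : rk N {y''} = 1) (hcly : y' ∈ clF N {y})
    (hcly'' : y'' ∈ clF N {y}) : InOutMinors N := by
  intro x w e hxg hwg hxw hx1 he hn₀ hR₀
  have hgr : gr ((N ／ ({x} : Set α)) ＼ ({w} : Set α)) = ((gr N).erase x).erase w := by
    rw [gr_delete', gr_contract']
  have hcard : (gr ((N ／ ({x} : Set α)) ＼ ({w} : Set α))).card = 12 := by
    rw [hgr, card_erase_of_mem (mem_erase.2 ⟨hxw.symm, hwg⟩), card_erase_of_mem hxg, hn]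
  have hrk₀ : rk ((N ／ ({x} : Set α)) ＼ ({w} : Set α)) (gr ((N ／ ({x} : Set α)) ＼ ({w} : Set α))) = 7 := by
    omega
  apply inCount_five_le_outCount_six_of_twelve_of_loop_or_parallel hcard hrk₀ he
  have hcly' : y ∈ clF N {y'} := mem_clF_singleton_of_parallel hy hy' hry hry' hcly
  have hcl'' : y'' ∈ clF N {y'} := mem_clF_singleton_trans hy' hy hy'' hcly' hcly''
  by_cases hxy : x ∈ clF N {y}
  · have hyx : y ∈ clF N {x} := mem_clF_singleton_of_parallel hy hxg hry hx1 hxy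
    have hy'x : y' ∈ clF N {x} := mem_clF_singleton_trans hxg hy hy' hyx hcly
    have hy''x : y'' ∈ clF N {x} := mem_clF_singleton_trans hxg hy hy'' hyx hcly''
    by_cases h1 : y ≠ x ∧ y ≠ w
    · exact Or.inl (exists_loop_minor_of_mem_clF hxg hx1 hy h1.1 h1.2 hyx)
    by_cases h2 : y' ≠ x ∧ y' ≠ w
    · exact Or.inl (exists_loop_minor_of_mem_clF hxg hx1 hy' h2.1 h2.2 hy'x)
    -- `y, y' ∈ {x, w}`, so `y'' ∉ {x, w}`
    have h3 : y'' ≠ x ∧ y'' ≠ w := by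
      rcases not_and_or.1 h1 with h | h <;> rcases not_and_or.1 h2 with h' | h' <;> push Not at h h'
      · exact absurd (h.trans h'.symm) hyy'
      · exact ⟨fun hc => hyy'' (h.trans hc.symm), fun hc => hy'y'' (h'.trans hc.symm)⟩
      · exact ⟨fun hc => hy'y'' (h'.trans hc.symm), fun hc => hyy'' (h.trans hc.symm)⟩
      · exact absurd (h.trans h'.symm) hyy'
    exact Or.inl (exists_loop_minor_of_mem_clF hxg hx1 hy'' h3.1 h3.2 hy''x)
  · have hxy1 : y ≠ x := fun h => hxy (h ▸ subset_clF_self_of_subset_gr (singleton_subset_iff.2 hy) (mem_singleton_self y))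
    have hxy2 : y' ≠ x := fun h => hxy (h ▸ hcly)
    have hxy3 : y'' ≠ x := fun h => hxy (h ▸ hcly'')
    have hxy' : x ∉ clF N {y'} := fun h => hxy (mem_clF_singleton_trans hy hy' hxg hcly h)
    by_cases hw1 : y ≠ w
    · by_cases hw2 : y' ≠ w
      · exact Or.inr (exists_parallel_minor hxg hx1 hy hy' hxy1 hw1 hxy2 hw2 hyy' hry hry' hcly hxy)
      · push Not at hw2
        have hw3 : y'' ≠ w := fun h => hy'y'' (hw2.trans h.symm)
        exact Or.inr (exists_parallel_minor hxg hx1 hy hy'' hxy1 hw1 hxy3 hw3 hyy'' hry hry'' hcly'' hxy)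
    · push Not at hw1
      have hw2 : y' ≠ w := fun h => hyy' (hw1.trans h.symm)
      have hw3 : y'' ≠ w := fun h => hyy'' (hw1.trans h.symm)
      exact Or.inr (exists_parallel_minor hxg hx1 hy' hy'' hxy2 hw2 hxy3 hw3 hy'y'' hry' hry'' hcl'' hxy')

/-- **THEOREM A'S STEP AT THE LEVEL `6` ON `14` POINTS OF RANK `8` WITH TWO PARALLEL PAIRS**: `8·P_6 ≤ 7·P_7`. -/
theorem biIndep_step_six_of_fourteen_of_two_parallel_pairs (hn : (gr N).card = 14) (hR : rk N (gr N) = 8)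
    {y y' z z' : α} (hy : y ∈ gr N) (hy' : y' ∈ gr N) (hz : z ∈ gr N) (hz' : z' ∈ gr N) (hyy' : y ≠ y')
    (hzz' : z ≠ z') (hyz : y ≠ z) (hyz' : y ≠ z') (hy'z : y' ≠ z) (hy'z' : y' ≠ z') (hry : rk N {y} = 1)
    (hry' : rk N {y'} = 1) (hrz : rk N {z} = 1) (hrz' : rk N {z'} = 1) (hcly : y' ∈ clF N {y})
    (hclz : z' ∈ clF N {z}) (hsep : z ∉ clF N {y}) :
    8 * (biIndepSets N 6).card ≤ 7 * (biIndepSets N 7).card := by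
  have h := biIndep_step_six_of_nullity_six_of_minors
    (inOutMinors_of_two_parallel_pairs hn hy hy' hz hz' hyy' hzz' hyz hyz' hy'z hy'z' hry hry' hrz hrz' hcly hclz hsep)
    (inOutPairMinors_of_fourteen hn) (by omega) (by omega)
  rw [hn] at h
  exact h

/-- **THE `q = 7` ROW AT `n = 14` ON EVERY MATROID WITH TWO PARALLEL PAIRS IN DIFFERENT CLASSES**: the co-rank-7 top
threshold `ThresholdIneq N 7 7` on `#E = 14`, `ρ(E) = 8`. -/
theorem thresholdIneq_seven_top_of_fourteen_of_two_parallel_pairs (hn : (gr N).card = 14) (hR : rk N (gr N) = 8)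
    {y y' z z' : α} (hy : y ∈ gr N) (hy' : y' ∈ gr N) (hz : z ∈ gr N) (hz' : z' ∈ gr N) (hyy' : y ≠ y')
    (hzz' : z ≠ z') (hyz : y ≠ z) (hyz' : y ≠ z') (hy'z : y' ≠ z) (hy'z' : y' ≠ z') (hry : rk N {y} = 1)
    (hry' : rk N {y'} = 1) (hrz : rk N {z} = 1) (hrz' : rk N {z'} = 1) (hcly : y' ∈ clF N {y})
    (hclz : z' ∈ clF N {z}) (hsep : z ∉ clF N {y}) : ThresholdIneq N 7 7 := by
  have h := thresholdIneq_seven_top_of_nullity_le_six_of_minors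
    (inOutMinors_of_two_parallel_pairs hn hy hy' hz hz' hyy' hzz' hyz hyz' hy'z hy'z' hry hry' hrz hrz' hcly hclz hsep)
    (inOutPairMinors_of_fourteen hn) (by omega) (by omega)
  rw [hR] at h
  exact h

/-- **THEOREM A'S STEP AT THE LEVEL `6` ON `14` POINTS OF RANK `8` WITH A PARALLEL TRIPLE**: `8·P_6 ≤ 7·P_7`. -/
theorem biIndep_step_six_of_fourteen_of_parallel_triple (hn : (gr N).card = 14) (hR : rk N (gr N) = 8)
    {y y' y'' : α} (hy : y ∈ gr N) (hy' : y' ∈ gr N) (hy'' : y'' ∈ gr N) (hyy' : y ≠ y') (hyy'' : y ≠ y'')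
    (hy'y'' : y' ≠ y'') (hry : rk N {y} = 1) (hry' : rk N {y'} = 1) (hry'' : rk N {y''} = 1)
    (hcly : y' ∈ clF N {y}) (hcly'' : y'' ∈ clF N {y}) :
    8 * (biIndepSets N 6).card ≤ 7 * (biIndepSets N 7).card := by
  have h := biIndep_step_six_of_nullity_six_of_minors
    (inOutMinors_of_parallel_triple hn hy hy' hy'' hyy' hyy'' hy'y'' hry hry' hry'' hcly hcly'')
    (inOutPairMinors_of_fourteen hn) (by omega) (by omega)
  rw [hn] at h
  exact h

/-- **THE `q = 7` ROW AT `n = 14` ON EVERY MATROID WITH A PARALLEL TRIPLE**: `ThresholdIneq N 7 7` on `#E = 14`,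
`ρ(E) = 8`. -/
theorem thresholdIneq_seven_top_of_fourteen_of_parallel_triple (hn : (gr N).card = 14) (hR : rk N (gr N) = 8)
    {y y' y'' : α} (hy : y ∈ gr N) (hy' : y' ∈ gr N) (hy'' : y'' ∈ gr N) (hyy' : y ≠ y') (hyy'' : y ≠ y'')
    (hy'y'' : y' ≠ y'') (hry : rk N {y} = 1) (hry' : rk N {y'} = 1) (hry'' : rk N {y''} = 1)
    (hcly : y' ∈ clF N {y}) (hcly'' : y'' ∈ clF N {y}) : ThresholdIneq N 7 7 := by
  have h := thresholdIneq_seven_top_of_nullity_le_six_of_minors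
    (inOutMinors_of_parallel_triple hn hy hy' hy'' hyy' hyy'' hy'y'' hry hry' hry'' hcly hcly'')
    (inOutPairMinors_of_fourteen hn) (by omega) (by omega)
  rw [hR] at h
  exact h

end FourteenParallel

end PercRepro.Cogirth
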